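import Summits.AtomisticToContinuum.HydrodynamicLimit.Theorems.RelayRaceLocalityConeLocalisationStubLogCurvatureB
import HarnessLib

/-!
# RelayRaceLocality · ConeLocalisation — line `einstein-elevator`, stub `stub_logCurvature` (part C)

Support file for the crux item `stmt-AtomisticToContinuum-12504` (`ConeLocalisation`, route RelayRaceLocality of
`AtomisticToContinuum/HydrodynamicLimit`), third of the files proving the registered stub
`stub_logCurvature : DynamicLogSlopeBound → DynamicLogCurvatureBound` of the line `einstein-elevator`.

This part (namespace `…Elevator.LogCurvature`): the material-derivative bounds one derivative up at
a guarded point (`pointwise_bounds2`: `σ³|D_t ∂ᵢρ| ≤ 15N²`, `|D_t ∂ᵢ∂ⱼθ| ≤ 48N⁵`,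
`|D_t ∂ᵢ∂ⱼ log ρ| ≤ 3N + N Σ|∂ log ρ| + N Σ|∂² log ρ|`), and the LAGRANGIAN STEP along a
characteristic `γ` of `u`: (i) `d/ds ∂ᵢuⱼ(s, γ s) = -(gᵢⱼ + rᵢⱼ)` with `g = ∂G ∘ γ`,
`rᵢⱼ = Σₖ ∂ᵢuₖ ∂ₖuⱼ`, `|r| ≤ 3N²` (`lagrangian_du`); (ii) `‖d/ds g‖ ≤ A + B q + C h` where `q`, `h`
bound `|∂ log ρ|`, `|∂² log ρ|` at the point (`lagrangian_dg`, bookkeeping calculus of part A fed by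
the Eulerian bounds of `LogSlope` and part B).
-/

noncomputable section

namespace Summit.AtomisticToContinuum.HydrodynamicLimit.Theorems.ConeLocalisation.Elevator.LogCurvature

open scoped Topology ContDiff NNReal
open Filter Set MeasureTheory
open Literature.MathematicalPhysics.KineticTheory Literature.Analysis.FluidPDE
  Literature.Analysis.FunctionSpaces
open Literature.Analysis.FluidPDE.CompressibleEuler (abs_mul_le_of_le)
open Literature.MathematicalPhysics.KineticTheory.HsEulerCalc

variable {σ T η₀ : ℝ} {ρ θ : ℝ → T3 → ℝ} {u : ℝ → T3 → V3} {Zf : ℝ → ℝ}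

/-! ### Step 8: material-derivative bounds one derivative up, at a guarded point -/

/-- **Material derivative of the log-density Hessian, bound** (floor-free): at a guarded point,
`|D_t ∂ᵢ∂ⱼ log ρ| ≤ 3N + N Σₖ |∂ₖ log ρ| + N Σₖ (|∂ᵢ∂ₖ log ρ| + |∂ₖ∂ⱼ log ρ|)` (from `Dt_logCurv` and
the guards `|∂u|, |∂²u|, |∂³u| ≤ N`). [folklore] -/
theorem abs_Dt_logCurv_le (hE : IsHardSphereEulerSolution σ T ρ u θ) {η M N : ℝ} (hMN : M ≤ N)
    {s : ℝ} (hs : s ∈ Ico 0 T) {x : T3} (hG : GuardAt η M σ ρ θ u s x) (i j : Fin 3) :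
    |Torus.timeDerivWithin (Ico 0 T)
          (fun s => Torus.partialDeriv i (Torus.partialDeriv j (fun z => Real.log (ρ s z)))) s x +
        ∑ k, u s x k * Torus.partialDeriv k
          (Torus.partialDeriv i (Torus.partialDeriv j (fun z => Real.log (ρ s z)))) x| ≤
      3 * N + N * ∑ k, |Torus.partialDeriv k (fun z => Real.log (ρ s z)) x| +
        N * ∑ k, (|Torus.partialDeriv i (Torus.partialDeriv k (fun z => Real.log (ρ s z))) x| +
          |Torus.partialDeriv k (Torus.partialDeriv j (fun z => Real.log (ρ s z))) x|) := by
  have hus : Torus.IsSmooth (u s) := hE.smooth_velocity.isSmooth_slice hs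
  obtain ⟨-, -, -, -, -, -, -, hdu, hddu⟩ := LogSlope.guard_bounds hG hMN hus
  obtain ⟨-, -, -, hdddu⟩ := guard_bounds3 hG hMN hus
  rw [Dt_logCurv hE hs x i j]
  simp only [Fin.sum_univ_three]
  have hd3 : |Torus.partialDeriv i (Torus.partialDeriv j (Torus.partialDeriv 0 fun y => u s y 0)) x +
      Torus.partialDeriv i (Torus.partialDeriv j (Torus.partialDeriv 1 fun y => u s y 1)) x +
      Torus.partialDeriv i (Torus.partialDeriv j (Torus.partialDeriv 2 fun y => u s y 2)) x| ≤
      3 * N := by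
    rw [abs_le]
    constructor <;> linarith [(abs_le.1 (hdddu i j 0 0)).1, (abs_le.1 (hdddu i j 0 0)).2,
      (abs_le.1 (hdddu i j 1 1)).1, (abs_le.1 (hdddu i j 1 1)).2, (abs_le.1 (hdddu i j 2 2)).1,
      (abs_le.1 (hdddu i j 2 2)).2]
  have A0 := abs_mul_le_of_le (hddu i j 0)
    (le_refl |Torus.partialDeriv 0 (fun z => Real.log (ρ s z)) x|)
  have A1 := abs_mul_le_of_le (hddu i j 1)
    (le_refl |Torus.partialDeriv 1 (fun z => Real.log (ρ s z)) x|)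
  have A2 := abs_mul_le_of_le (hddu i j 2)
    (le_refl |Torus.partialDeriv 2 (fun z => Real.log (ρ s z)) x|)
  have B0 := abs_mul_le_of_le (hdu j 0)
    (le_refl |Torus.partialDeriv i (Torus.partialDeriv 0 (fun z => Real.log (ρ s z))) x|)
  have B1 := abs_mul_le_of_le (hdu j 1)
    (le_refl |Torus.partialDeriv i (Torus.partialDeriv 1 (fun z => Real.log (ρ s z))) x|)
  have B2 := abs_mul_le_of_le (hdu j 2)
    (le_refl |Torus.partialDeriv i (Torus.partialDeriv 2 (fun z => Real.log (ρ s z))) x|)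
  have C0 := abs_mul_le_of_le (hdu i 0)
    (le_refl |Torus.partialDeriv 0 (Torus.partialDeriv j (fun z => Real.log (ρ s z))) x|)
  have C1 := abs_mul_le_of_le (hdu i 1)
    (le_refl |Torus.partialDeriv 1 (Torus.partialDeriv j (fun z => Real.log (ρ s z))) x|)
  have C2 := abs_mul_le_of_le (hdu i 2)
    (le_refl |Torus.partialDeriv 2 (Torus.partialDeriv j (fun z => Real.log (ρ s z))) x|)
  rw [abs_le]
  constructor <;> nlinarith [(abs_le.1 hd3).1, (abs_le.1 hd3).2, (abs_le.1 A0).1, (abs_le.1 A0).2,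
    (abs_le.1 A1).1, (abs_le.1 A1).2, (abs_le.1 A2).1, (abs_le.1 A2).2, (abs_le.1 B0).1,
    (abs_le.1 B0).2, (abs_le.1 B1).1, (abs_le.1 B1).2, (abs_le.1 B2).1, (abs_le.1 B2).2,
    (abs_le.1 C0).1, (abs_le.1 C0).2, (abs_le.1 C1).1, (abs_le.1 C1).2, (abs_le.1 C2).1,
    (abs_le.1 C2).2]

/-- **Material-derivative bounds at a guarded point, one derivative up** (level `N ≥ max M K`):
`σ³ |D_t ∂ᵢρ| ≤ 15N²`, `|D_t ∂ᵢ∂ⱼθ| ≤ 48N⁵`, and the floor-free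
`|D_t ∂ᵢ∂ⱼ log ρ| ≤ 3N + N Σₖ |∂ₖ log ρ| + N Σₖ (|∂ᵢ∂ₖ log ρ| + |∂ₖ∂ⱼ log ρ|)`. [folklore] -/
theorem pointwise_bounds2 (hE : IsHardSphereEulerSolution σ T ρ u θ)
    (hZ : ContDiffOn ℝ ∞ Zf (Ioo (-η₀) η₀)) (hEq : EqOn hsCompressibility Zf (Ioo 0 η₀))
    (hσ : 0 < σ) (hσ1 : σ ≤ 1) {η₁ K M N : ℝ} (hη₁₀ : 2 * η₁ ≤ η₀)
    (hband : ∀ η ∈ Icc 0 η₁, |Zf η| ≤ K ∧ |deriv Zf η| ≤ K ∧ |deriv (deriv Zf) η| ≤ K ∧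
      |deriv (deriv (deriv Zf)) η| ≤ K ∧ 1 / 2 ≤ Zf η ∧ 1 / 2 ≤ Zf η + η * deriv Zf η)
    (hN : 1 ≤ N) (hMN : M ≤ N) (hKN : K ≤ N)
    (hpack : ∀ s ∈ Ico 0 T, ∀ x, ρ s x * σ ^ 3 < η₁)
    {s : ℝ} (hs : s ∈ Ico 0 T) {x : T3} (hG : GuardAt η₁ M σ ρ θ u s x) :
    (∀ i, |(Torus.timeDerivWithin (Ico 0 T) (fun s => Torus.partialDeriv i (ρ s)) s x +
        ∑ k, u s x k * Torus.partialDeriv k (Torus.partialDeriv i (ρ s)) x) * σ ^ 3| ≤ 15 * N ^ 2) ∧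
    (∀ i j, |Torus.timeDerivWithin (Ico 0 T)
          (fun s => Torus.partialDeriv i (Torus.partialDeriv j (θ s))) s x +
        ∑ k, u s x k *
          Torus.partialDeriv k (Torus.partialDeriv i (Torus.partialDeriv j (θ s))) x| ≤ 48 * N ^ 5) ∧
    (∀ i j, |Torus.timeDerivWithin (Ico 0 T)
          (fun s => Torus.partialDeriv i (Torus.partialDeriv j (fun z => Real.log (ρ s z)))) s x +
        ∑ k, u s x k * Torus.partialDeriv k
          (Torus.partialDeriv i (Torus.partialDeriv j (fun z => Real.log (ρ s z)))) x| ≤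
      3 * N + N * ∑ k, |Torus.partialDeriv k (fun z => Real.log (ρ s z)) x| +
        N * ∑ k, (|Torus.partialDeriv i (Torus.partialDeriv k (fun z => Real.log (ρ s z))) x| +
          |Torus.partialDeriv k (Torus.partialDeriv j (fun z => Real.log (ρ s z))) x|)) := by
  have hσ3 : |σ ^ 3| ≤ 1 := by
    rw [abs_of_pos (pow_pos hσ 3)]
    exact pow_le_one₀ hσ.le hσ1
  refine ⟨fun i => ?_, fun i j =>
    abs_Dt_ddTemperature_le hE hZ hEq hσ hσ1 hη₁₀ hband hN hMN hKN hpack hs hG i j,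
    fun i j => abs_Dt_logCurv_le hE hMN hs hG i j⟩
  have h := abs_mul_le_of_le (abs_Dt_dDensity_le hE hMN hs hG i) hσ3
  linarith

/-! ### Step 9: the Lagrangian step, one derivative up -/

section Lagrangian

/-- **Velocity gradient along a characteristic.** Along `γ` (`γ' = u(s, γ)` within `[0, t]`):
`d/ds ∂ᵢuⱼ(s, γ s) = -(gᵢⱼ(s) + rᵢⱼ(s))` with `g = ∂G ∘ γ` (displayed through `hg`) and
`rᵢⱼ = Σₖ ∂ᵢuₖ ∂ₖuⱼ`, `|rᵢⱼ| ≤ 3N²`, `|∂ᵢuⱼ| ≤ N` at guarded points. [folklore] -/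
theorem lagrangian_du (hE : IsHardSphereEulerSolution σ T ρ u θ)
    (hZ : ContDiffOn ℝ ∞ Zf (Ioo (-η₀) η₀)) (hEq : EqOn hsCompressibility Zf (Ioo 0 η₀))
    (hσ : 0 < σ) {η₁ M N : ℝ} (hη₁₀ : 2 * η₁ ≤ η₀) (hMN : M ≤ N)
    (hpack : ∀ s ∈ Ico 0 T, ∀ x, ρ s x * σ ^ 3 < η₁)
    {t : ℝ} (ht : 0 < t) (htT : t < T) (hG : ∀ s ∈ Icc 0 t, ∀ x, GuardAt η₁ M σ ρ θ u s x)
    {γ : ℝ → V3} {τ : ℝ} (hτ : τ ∈ Icc 0 t)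
    (hγ : HasDerivWithinAt γ (Torus.lift (u τ) (γ τ)) (Icc 0 t) τ)
    {g r : ℝ → Fin 3 → Fin 3 → ℝ}
    (hg : ∀ s i j, g s i j =
      (Torus.partialDeriv i (θ s) (Torus.proj (γ s)) *
            (Zf (ρ s (Torus.proj (γ s)) * σ ^ 3) + ρ s (Torus.proj (γ s)) * σ ^ 3 *
              deriv Zf (ρ s (Torus.proj (γ s)) * σ ^ 3)) +
          θ s (Torus.proj (γ s)) * ((2 * deriv Zf (ρ s (Torus.proj (γ s)) * σ ^ 3) +
            ρ s (Torus.proj (γ s)) * σ ^ 3 *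
              deriv (deriv Zf) (ρ s (Torus.proj (γ s)) * σ ^ 3)) *
            (Torus.partialDeriv i (ρ s) (Torus.proj (γ s)) * σ ^ 3))) *
          Torus.partialDeriv j (fun z => Real.log (ρ s z)) (Torus.proj (γ s)) +
        θ s (Torus.proj (γ s)) * (Zf (ρ s (Torus.proj (γ s)) * σ ^ 3) +
            ρ s (Torus.proj (γ s)) * σ ^ 3 * deriv Zf (ρ s (Torus.proj (γ s)) * σ ^ 3)) *
          Torus.partialDeriv i (Torus.partialDeriv j (fun z => Real.log (ρ s z))) (Torus.proj (γ s)) +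
        (deriv Zf (ρ s (Torus.proj (γ s)) * σ ^ 3) *
              (Torus.partialDeriv i (ρ s) (Torus.proj (γ s)) * σ ^ 3) *
            Torus.partialDeriv j (θ s) (Torus.proj (γ s)) +
          Zf (ρ s (Torus.proj (γ s)) * σ ^ 3) *
            Torus.partialDeriv i (Torus.partialDeriv j (θ s)) (Torus.proj (γ s))))
    (hr : ∀ s i j, r s i j = ∑ k, Torus.partialDeriv i (fun z => u s z k) (Torus.proj (γ s)) *
      Torus.partialDeriv k (fun z => u s z j) (Torus.proj (γ s))) (i j : Fin 3) :
    HasDerivWithinAt (fun s => Torus.partialDeriv i (fun z => u s z j) (Torus.proj (γ s)))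
        (-(g τ i j + r τ i j)) (Icc 0 t) τ ∧
      |r τ i j| ≤ 3 * N ^ 2 ∧ |Torus.partialDeriv i (fun z => u τ z j) (Torus.proj (γ τ))| ≤ N := by
  have hsub : Icc 0 t ⊆ Ico 0 T := Icc_subset_Ico_right htT
  have hτ' : τ ∈ Ico 0 T := hsub hτ
  have hU : UniqueDiffOn ℝ (Ico (0 : ℝ) T) := uniqueDiffOn_Ico 0 T
  have hGτ := hG τ hτ (Torus.proj (γ τ))
  have hη₁ : 0 < η₁ := (mul_pos (hE.density_pos τ hτ' _) (pow_pos hσ 3)).trans hGτ.1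
  have hη₀ : ∀ s ∈ Ico 0 T, ∀ x, ρ s x * σ ^ 3 < η₀ := fun s' hs' x' =>
    (hpack s' hs' x').trans_le (by linarith)
  have hus : Torus.IsSmooth (u τ) := hE.smooth_velocity.isSmooth_slice hτ'
  obtain ⟨-, -, -, -, -, -, -, hdu, -⟩ := LogSlope.guard_bounds hGτ hMN hus
  have a := LogSlope.hasDerivWithinAt_along (u := u)
    ((hE.smooth_velocity.apply j).partialDeriv hU i) ht htT hτ hγ rfl
  refine ⟨a.congr_deriv ?_, ?_, hdu i j⟩
  · rw [hg, hr, Dt_dVelocity hE hZ hEq hσ hη₀ hτ' _ i j]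
    ring
  · rw [hr]
    simp only [Fin.sum_univ_three]
    have c0 := abs_mul_le_of_le (hdu i 0) (hdu 0 j)
    have c1 := abs_mul_le_of_le (hdu i 1) (hdu 1 j)
    have c2 := abs_mul_le_of_le (hdu i 2) (hdu 2 j)
    have h := (abs_add_le _ _).trans (add_le_add ((abs_add_le _ _).trans (add_le_add c0 c1)) c2)
    linarith

/-- **The pressure-gradient gradient along a characteristic.** Along `γ`, at a guarded point where
`|∂ₖ log ρ| ≤ q` on `[0, t] × 𝕋³` and `|∂ₖ∂ₗ log ρ| ≤ h` at the point, the matrix `g = ∂G ∘ γ`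
(displayed through `hg`) has `‖d/ds g‖ ≤ 105 N⁶ + 123 N⁵ q + 25 N⁴ h` (bookkeeping calculus fed
by the material-derivative bounds of orders one and two). [folklore] -/
theorem lagrangian_dg (hE : IsHardSphereEulerSolution σ T ρ u θ)
    (hZ : ContDiffOn ℝ ∞ Zf (Ioo (-η₀) η₀)) (hEq : EqOn hsCompressibility Zf (Ioo 0 η₀))
    (hσ : 0 < σ) (hσ1 : σ ≤ 1) {η₁ K M N q hh : ℝ} (hη₁1 : η₁ ≤ 1) (hη₁₀ : 2 * η₁ ≤ η₀)
    (hband : ∀ η ∈ Icc 0 η₁, |Zf η| ≤ K ∧ |deriv Zf η| ≤ K ∧ |deriv (deriv Zf) η| ≤ K ∧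
      |deriv (deriv (deriv Zf)) η| ≤ K ∧ 1 / 2 ≤ Zf η ∧ 1 / 2 ≤ Zf η + η * deriv Zf η)
    (hN : 1 ≤ N) (hMN : M ≤ N) (hKN : K ≤ N)
    (hpack : ∀ s ∈ Ico 0 T, ∀ x, ρ s x * σ ^ 3 < η₁)
    {t : ℝ} (ht : 0 < t) (htT : t < T) (hG : ∀ s ∈ Icc 0 t, ∀ x, GuardAt η₁ M σ ρ θ u s x)
    (hq : 0 ≤ q)
    (hQ : ∀ s ∈ Icc 0 t, ∀ x k, |Torus.partialDeriv k (fun z => Real.log (ρ s z)) x| ≤ q)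
    {γ : ℝ → V3} {τ : ℝ} (hτ : τ ∈ Icc 0 t)
    (hγ : HasDerivWithinAt γ (Torus.lift (u τ) (γ τ)) (Icc 0 t) τ) (hh0 : 0 ≤ hh)
    (hH : ∀ k l, |Torus.partialDeriv k (Torus.partialDeriv l (fun z => Real.log (ρ τ z)))
      (Torus.proj (γ τ))| ≤ hh)
    {g : ℝ → Fin 3 → Fin 3 → ℝ}
    (hg : ∀ s i j, g s i j =
      (Torus.partialDeriv i (θ s) (Torus.proj (γ s)) *
            (Zf (ρ s (Torus.proj (γ s)) * σ ^ 3) + ρ s (Torus.proj (γ s)) * σ ^ 3 *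
              deriv Zf (ρ s (Torus.proj (γ s)) * σ ^ 3)) +
          θ s (Torus.proj (γ s)) * ((2 * deriv Zf (ρ s (Torus.proj (γ s)) * σ ^ 3) +
            ρ s (Torus.proj (γ s)) * σ ^ 3 *
              deriv (deriv Zf) (ρ s (Torus.proj (γ s)) * σ ^ 3)) *
            (Torus.partialDeriv i (ρ s) (Torus.proj (γ s)) * σ ^ 3))) *
          Torus.partialDeriv j (fun z => Real.log (ρ s z)) (Torus.proj (γ s)) +
        θ s (Torus.proj (γ s)) * (Zf (ρ s (Torus.proj (γ s)) * σ ^ 3) +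
            ρ s (Torus.proj (γ s)) * σ ^ 3 * deriv Zf (ρ s (Torus.proj (γ s)) * σ ^ 3)) *
          Torus.partialDeriv i (Torus.partialDeriv j (fun z => Real.log (ρ s z))) (Torus.proj (γ s)) +
        (deriv Zf (ρ s (Torus.proj (γ s)) * σ ^ 3) *
              (Torus.partialDeriv i (ρ s) (Torus.proj (γ s)) * σ ^ 3) *
            Torus.partialDeriv j (θ s) (Torus.proj (γ s)) +
          Zf (ρ s (Torus.proj (γ s)) * σ ^ 3) *
            Torus.partialDeriv i (Torus.partialDeriv j (θ s)) (Torus.proj (γ s)))) :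
    ∃ v, HasDerivWithinAt g v (Icc 0 t) τ ∧
      ‖v‖ ≤ 105 * N ^ 6 + 123 * N ^ 5 * q + 25 * N ^ 4 * hh := by
  have hsub : Icc 0 t ⊆ Ico 0 T := Icc_subset_Ico_right htT
  have hτ' : τ ∈ Ico 0 T := hsub hτ
  have hU : UniqueDiffOn ℝ (Ico (0 : ℝ) T) := uniqueDiffOn_Ico 0 T
  have hGτ := hG τ hτ (Torus.proj (γ τ))
  have hρpos := hE.density_pos τ hτ' (Torus.proj (γ τ))
  have hθpos := hE.temperature_pos τ hτ' (Torus.proj (γ τ))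
  have hepos : 0 < ρ τ (Torus.proj (γ τ)) * σ ^ 3 := mul_pos hρpos (pow_pos hσ 3)
  have hus : Torus.IsSmooth (u τ) := hE.smooth_velocity.isSmooth_slice hτ'
  obtain ⟨hpk, hθN, -, -, hdρ, hdθ, hddθ, -, -⟩ := LogSlope.guard_bounds hGτ hMN hus
  have hθa : |θ τ (Torus.proj (γ τ))| ≤ N := by rw [abs_of_pos hθpos]; exact hθN
  have hσ3 : |σ ^ 3| ≤ 1 := by
    rw [abs_of_pos (pow_pos hσ 3)]
    exact pow_le_one₀ hσ.le hσ1
  obtain ⟨he1, hZa, hZ'a, hZ''a, hZ'''a, -, -, -, dZ, dZ1, dZ2⟩ :=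
    eos_point hZ hη₁1 hη₁₀ hband hKN hepos hpk
  have hband5 : ∀ η ∈ Icc 0 η₁, |Zf η| ≤ K ∧ |deriv Zf η| ≤ K ∧ |deriv (deriv Zf) η| ≤ K ∧
      1 / 2 ≤ Zf η ∧ 1 / 2 ≤ Zf η + η * deriv Zf η := fun η hη =>
    ⟨(hband η hη).1, (hband η hη).2.1, (hband η hη).2.2.1, (hband η hη).2.2.2.2⟩
  -- material-derivative bounds at the point
  obtain ⟨bθ, bη, bΘ, bQ⟩ :=
    LogSlope.pointwise_bounds hE hZ hEq hσ hσ1 hη₁1 hη₁₀ hband5 hN hMN hKN hpack hτ' hGτ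
  obtain ⟨bdη, bΘ2, bH⟩ := pointwise_bounds2 hE hZ hEq hσ hσ1 hη₁₀ hband hN hMN hKN hpack hτ' hGτ
  have hQτ := hQ τ hτ (Torus.proj (γ τ))
  have hSQ : ∑ k, |Torus.partialDeriv k (fun z => Real.log (ρ τ z)) (Torus.proj (γ τ))| ≤ 3 * q := by
    simp only [Fin.sum_univ_three]
    linarith [hQτ 0, hQτ 1, hQτ 2]
  have hN0 : 0 ≤ N := by linarith
  have bQ' : ∀ k, |Torus.timeDerivWithin (Ico 0 T)
        (fun s => Torus.partialDeriv k (fun z => Real.log (ρ s z))) τ (Torus.proj (γ τ)) +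
      ∑ i, u τ (Torus.proj (γ τ)) i * Torus.partialDeriv i
        (Torus.partialDeriv k (fun z => Real.log (ρ τ z))) (Torus.proj (γ τ))| ≤
      3 * N + 3 * N * q := fun k =>
    (bQ k).trans (by nlinarith [hSQ])
  have bH' : ∀ k l, |Torus.timeDerivWithin (Ico 0 T)
        (fun s => Torus.partialDeriv k (Torus.partialDeriv l (fun z => Real.log (ρ s z)))) τ
          (Torus.proj (γ τ)) +
      ∑ m, u τ (Torus.proj (γ τ)) m * Torus.partialDeriv m
        (Torus.partialDeriv k (Torus.partialDeriv l (fun z => Real.log (ρ τ z))))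
          (Torus.proj (γ τ))| ≤ 3 * N + 3 * N * q + 6 * N * hh := by
    intro k l
    refine (bH k l).trans ?_
    have hS2 : ∑ m, (|Torus.partialDeriv k (Torus.partialDeriv m (fun z => Real.log (ρ τ z)))
        (Torus.proj (γ τ))| + |Torus.partialDeriv m (Torus.partialDeriv l
          (fun z => Real.log (ρ τ z))) (Torus.proj (γ τ))|) ≤ 6 * hh := by
      simp only [Fin.sum_univ_three]
      linarith [hH k 0, hH k 1, hH k 2, hH 0 l, hH 1 l, hH 2 l]
    nlinarith [hSQ, hS2]
  -- derivatives along `γ`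
  have hL := LogSlope.isSmoothSpaceTimeOn_log hE
  have aθ := LogSlope.hasDerivWithinAt_along (u := u) hE.smooth_temperature ht htT hτ hγ rfl
  have aρ := LogSlope.hasDerivWithinAt_along (u := u) hE.smooth_density ht htT hτ hγ rfl
  have aΘ := fun k => LogSlope.hasDerivWithinAt_along (u := u)
    (hE.smooth_temperature.partialDeriv hU k) ht htT hτ hγ rfl
  have aΘ2 := fun k l => LogSlope.hasDerivWithinAt_along (u := u)
    ((hE.smooth_temperature.partialDeriv hU l).partialDeriv hU k) ht htT hτ hγ rfl
  have adρ := fun k => LogSlope.hasDerivWithinAt_along (u := u)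
    (hE.smooth_density.partialDeriv hU k) ht htT hτ hγ rfl
  have aQ := fun k => LogSlope.hasDerivWithinAt_along (u := u) (hL.partialDeriv hU k) ht htT hτ hγ rfl
  have aH := fun k l => LogSlope.hasDerivWithinAt_along (u := u)
    ((hL.partialDeriv hU l).partialDeriv hU k) ht htT hτ hγ rfl
  -- bookkeeping atoms
  have Pθ := bd_atom aθ hθa bθ
  have Pη := bd_atom (aρ.mul_const (σ ^ 3)) he1 bη
  have PΘ := fun k => bd_atom (aΘ k) (hdθ k) (bΘ k)
  have PΘ2 := fun k l => bd_atom (aΘ2 k l) (hddθ k l) (bΘ2 k l)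
  have Pdη := fun k => bd_atom ((adρ k).mul_const (σ ^ 3)) (abs_mul_le_of_le (hdρ k) hσ3) (bdη k)
  have PQ := fun k => bd_atom (aQ k) (hQτ k) (bQ' k)
  have PH := fun k l => bd_atom (aH k l) (hH k l) (bH' k l)
  have PZ := bd_comp Pη dZ hZa hZ'a
  have PZ' := bd_comp Pη dZ1 hZ'a hZ''a
  have PZ'' := bd_comp Pη dZ2 hZ''a hZ'''a
  have h2 : |(2 : ℝ)| ≤ 2 := by norm_num
  have Pκ := bd_add PZ (bd_mul Pη PZ')
  have Pκ' := bd_add (bd_const_mul 2 h2 PZ') (bd_mul Pη PZ'')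
  have comp := fun i j => bd_add (bd_add
      (bd_mul (bd_add (bd_mul (PΘ i) Pκ) (bd_mul Pθ (bd_mul Pκ' (Pdη i)))) (PQ j))
      (bd_mul (bd_mul Pθ Pκ) (PH i j)))
    (bd_add (bd_mul (bd_mul PZ' (Pdη i)) (PΘ j)) (bd_mul PZ (PΘ2 i j)))
  -- powers of `N`
  have p16 : N ≤ N ^ 6 := le_self_pow₀ hN (by norm_num)
  have p26 : N ^ 2 ≤ N ^ 6 := pow_le_pow_right₀ hN (by norm_num)
  have p36 : N ^ 3 ≤ N ^ 6 := pow_le_pow_right₀ hN (by norm_num)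
  have p46 : N ^ 4 ≤ N ^ 6 := pow_le_pow_right₀ hN (by norm_num)
  have p56 : N ^ 5 ≤ N ^ 6 := pow_le_pow_right₀ hN (by norm_num)
  have p06 : 0 ≤ N ^ 6 := by positivity
  have q15 : N * q ≤ N ^ 5 * q := mul_le_mul_of_nonneg_right (le_self_pow₀ hN (by norm_num)) hq
  have q25 : N ^ 2 * q ≤ N ^ 5 * q :=
    mul_le_mul_of_nonneg_right (pow_le_pow_right₀ hN (by norm_num)) hq
  have q35 : N ^ 3 * q ≤ N ^ 5 * q :=
    mul_le_mul_of_nonneg_right (pow_le_pow_right₀ hN (by norm_num)) hq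
  have q45 : N ^ 4 * q ≤ N ^ 5 * q :=
    mul_le_mul_of_nonneg_right (pow_le_pow_right₀ hN (by norm_num)) hq
  have q05 : 0 ≤ N ^ 5 * q := by positivity
  have r14 : N * hh ≤ N ^ 4 * hh := mul_le_mul_of_nonneg_right (le_self_pow₀ hN (by norm_num)) hh0
  have r24 : N ^ 2 * hh ≤ N ^ 4 * hh :=
    mul_le_mul_of_nonneg_right (pow_le_pow_right₀ hN (by norm_num)) hh0
  have r34 : N ^ 3 * hh ≤ N ^ 4 * hh :=
    mul_le_mul_of_nonneg_right (pow_le_pow_right₀ hN (by norm_num)) hh0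
  have r04 : 0 ≤ N ^ 4 * hh := by positivity
  -- componentwise derivative of `g`
  have part : ∀ i j, ∃ d, HasDerivWithinAt (fun s => g s i j) d (Icc 0 t) τ ∧
      |d| ≤ 105 * N ^ 6 + 123 * N ^ 5 * q + 25 * N ^ 4 * hh := by
    intro i j
    obtain ⟨d, hd, -, hb⟩ := comp i j
    refine ⟨d, ?_, hb.trans ?_⟩
    · have e : (fun s => g s i j) = _ := funext fun s => hg s i j
      rw [e]
      exact hd
    · linarith
  choose d hd hdb using part
  refine ⟨fun i j => d i j, hasDerivWithinAt_pi.2 fun i => hasDerivWithinAt_pi.2 fun j => hd i j, ?_⟩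
  refine (pi_norm_le_iff_of_nonneg (by positivity)).2 fun i =>
    (pi_norm_le_iff_of_nonneg (by positivity)).2 fun j => ?_
  rw [Real.norm_eq_abs]
  exact hdb i j

end Lagrangian

end Summit.AtomisticToContinuum.HydrodynamicLimit.Theorems.ConeLocalisation.Elevator.LogCurvature

namespace Summit.AtomisticToContinuum.HydrodynamicLimit.Theorems.ConeLocalisation.Elevator

open Literature.MathematicalPhysics.KineticTheory Literature.Analysis.FunctionSpaces

/-- **Registered sub-goal `stub_logCurvature_partC` of the stub `stub_logCurvature`** (part C of its proof,
registered on stmt-AtomisticToContinuum-12504 for the supports lane): the floor-free guarded bound on the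
material derivative of the log-density Hessian. [folklore] -/
theorem stub_logCurvature_partC : ∀ {σ T : ℝ} {ρ θ : ℝ → T3 → ℝ} {u : ℝ → T3 → V3}, IsHardSphereEulerSolution σ T ρ u θ → ∀ {η M N : ℝ}, M ≤ N → ∀ {s : ℝ}, s ∈ Set.Ico 0 T → ∀ {x : T3}, GuardAt η M σ ρ θ u s x → ∀ (i j : Fin 3), |Torus.timeDerivWithin (Set.Ico 0 T) (fun s => Torus.partialDeriv i (Torus.partialDeriv j (fun z => Real.log (ρ s z)))) s x + ∑ k, u s x k * Torus.partialDeriv k (Torus.partialDeriv i (Torus.partialDeriv j (fun z => Real.log (ρ s z)))) x| ≤ 3 * N + N * ∑ k, |Torus.partialDeriv k (fun z => Real.log (ρ s z)) x| + N * ∑ k, (|Torus.partialDeriv i (Torus.partialDeriv k (fun z => Real.log (ρ s z))) x| + |Torus.partialDeriv k (Torus.partialDeriv j (fun z => Real.log (ρ s z))) x|) :=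
  fun hE _ _ _ hMN _ hs _ hG i j => LogCurvature.abs_Dt_logCurv_le hE hMN hs hG i j

end Summit.AtomisticToContinuum.HydrodynamicLimit.Theorems.ConeLocalisation.Elevator

end
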